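import Summits.BirchSwinnertonDyer.BirchSwinnertonDyer.Theses.TwistFamilyManinDescent
import Summits.BirchSwinnertonDyer.BirchSwinnertonDyer.Theorems.ManinLocalTwoThreeManinPrimeToAdditiveFiveLeCornersOfStrongIsUnstarred
import Literature.NumberTheory.EllipticCurves.BSDRootNumberLocalTablesProofs
import HarnessLib

/-!
# Route `ManinLocalTwoThree`, residual crux C5 `ManinPrimeToAdditiveFiveLe` (stmt-BirchSwinnertonDyer-22969), line
# `upper_anchor` (skeleton v13, registered stub `stub_ord57` = `TwistFamilyManinDescent.OrdinaryCornerManinResidual` stmt-27552):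
# **route `TwistFamilyManinDescent`'s LINE-18R bookkeeping is a THEOREM — `OrdinaryCornerOffTable` (stmt-BirchSwinnertonDyer-27663)
# outright; with the glue `OrdinaryCornerOfSerreTateDepth` (stmt-27664, landed by seat bsd-line-ttd-p1 g9) stmt-27552 ⟸ I9 (stmt-27660) ∧
# K18a″ (stmt-27661) ∧ K18b″ (stmt-27662) BY NAME**

Lead seat bsd-line-ml23-c5-p1 (gen 7). `stub_ord57` of the C5 skeleton is route `TwistFamilyManinDescent`'s declared residual
`OrdinaryCornerManinResidual` (stmt-27552: the potentially ORDINARY `W[p]`-reducible corner rows `(5; III/III*)`,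
`(7; II/IV/IV*/II*)` plus the vacuous rows). Its planner (bsd-idea-3 g7, LINE 18R, critic V#91 PASS-WITH-PRICE) SPLIT it into
I9 `OrdinaryCornerOptimalSerreTateDeep` (27660) ∧ K18a″ `OrdinaryCornerDeepEdixhovenDichotomy` (27661) ∧ K18b″
`OrdinaryCornerDeepUnstarredNotBottom` (27662) ∧ the bookkeeping `OrdinaryCornerOffTable` (27663, «PROVABLE NOW (S/M)») through
the glue `OrdinaryCornerOfSerreTateDepth` (27664; landed by seat bsd-line-ttd-p1 g9, p635307). THIS FILE lands the vacuous-rows piece as a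
kernel theorem against the route file:

* §1 `ordinaryCornerOffTable_proof : OrdinaryCornerOffTable` — the rows of stmt-27552 OUTSIDE the ordinary table are EMPTY.
  Level = conductor (Carayol); `p² ∣ N` ⟹ `W` additive at `p`; «`W ⊗ p*` neither good nor multiplicative at `p`» ⟹
  `0 ≤ ord_p j(W)` (`padicValRat_j_nonneg_of_addv_of_twist_pStar_not_semistable`); so `ord_p Δ_min(W) ∈ {2,3,4,6,8,9,10}`
  (Kodaira at an additive potentially good `p ≥ 5`), and after the Raynaud rows, the supersingular rows and the ordinary-table
  rows are removed only `ord_p Δ_min = 6` (I₀*) is left — but then the globally minimal model `C` of `W ⊗ p*` (additive at `p`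
  by hypothesis, `0 ≤ ord_p j(C) = ord_p j(W)`) would have `ord_p Δ_min(C) = 12 − 12·ord_p u ∈ {2,…,10}`
  (`padicValInt_minimalDiscriminantInt_twist_pStar_eq`), impossible. No Kodaira-symbol transport, no `I₀*`-twist lemma needed.
(The glue `OrdinaryCornerOfSerreTateDepth` stmt-27664 was landed concurrently by seat bsd-line-ttd-p1 g9, p635307,
`TwistFamilyManinDescent.ordinaryCornerOfSerreTateDepth_proof`; with §1 it gives stmt-27552 ⟸ I9 ∧ K18a″ ∧ K18b″ BY NAME — a one-line
corollary left to the consumer to keep this module off that import.)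

CONSEQUENCES (by name): stmt-27663 closes `--by …ordinaryCornerOffTable_proof`; the open content of stmt-27552 (hence of C5's
`stub_ord57`) is exactly {I9 stmt-27660, K18a″ stmt-27661, K18b″ stmt-27662}. HONEST STATUS: those three are OPEN; nothing here
proves them, 27552, C5, Manin's conjecture or BSD.

References: [EdixhovenManin1991] Thm. 3, Prop. 7, §4; [SilvermanATAEC1994] IV Table 4.1, IV.10; [SilvermanAEC2009] VII.5
Prop. 5.1; [Carayol1986]; [AtkinLehner1970] Thm. 4; [Stevens1989] §2.
-/

set_option autoImplicit false
-- the Theorems namespace of this sub repeats the summit name by design (D-0017 nested layout)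
set_option linter.dupNamespace false

noncomputable section

open scoped Classical NumberField

namespace Summit.BirchSwinnertonDyer.BirchSwinnertonDyer.Theorems

open WeierstrassCurve IsDedekindDomain IsDedekindDomain.HeightOneSpectrum Rat.HeightOneSpectrum NumberField
  Literature.NumberTheory.EllipticCurves Literature.NumberTheory.EllipticCurves.ModularForms
  Literature.NumberTheory.EllipticCurves.Rank1Residual
  Literature.NumberTheory.DiophantineGeometry
  Summit.BirchSwinnertonDyer.Rank1Residual
  Summit.BirchSwinnertonDyer.Rank1Residual.ManinAdditive
  Summit.BirchSwinnertonDyer.Rank1Residual.Additive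
  Summit.BirchSwinnertonDyer.BirchSwinnertonDyer.Theses.TwistFamilyManinDescent


/-! ## §1 `OrdinaryCornerOffTable` (stmt-BirchSwinnertonDyer-27663): the rows outside the ordinary table are empty -/

/-- **No row is left**: at an additive `p ≥ 5` with `W ⊗ p*` neither good nor multiplicative at `p` (so `0 ≤ ord_p j`),
`ord_p Δ_min(W) ≠ 6` — the globally minimal model `C` of `W ⊗ p*` would have `ord_p Δ_min(C) ≡ 0 (mod 12)` and be additive
potentially good at `p`, i.e. `ord_p Δ_min(C) ∈ {2, 3, 4, 6, 8, 9, 10}`, impossible. (Classically: `I₀*` is the ramified quadratic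
twist of good reduction.) [cite: SilvermanATAEC1994, IV Table 4.1] [cite: Pal2012, Prop. 2.5] -/
theorem padicValInt_minimalDiscriminantInt_ne_six_of_twist_pStar_not_semistable {p : ℕ}
    [hpF : Fact p.Prime] (hp5 : 5 ≤ p) (W : WeierstrassCurve ℚ) [W.IsElliptic] [W.IsGloballyMinimal]
    (hpN : p ^ 2 ∣ W.conductorNorm ℤ)
    (htw : ¬ ((W.quadraticTwist (((-1 : ℤ) ^ (p / 2) * p : ℤ) : ℚ)).HasGoodReductionAt
          ((Rat.HeightOneSpectrum.primesEquiv (R := ℤ)).symm ⟨p, hpF.out⟩) ∨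
        (W.quadraticTwist (((-1 : ℤ) ^ (p / 2) * p : ℤ) : ℚ)).HasMultiplicativeReductionAt
          ((Rat.HeightOneSpectrum.primesEquiv (R := ℤ)).symm ⟨p, hpF.out⟩))) :
    padicValInt p W.minimalDiscriminantInt ≠ 6 := by
  have hp : p.Prime := hpF.out
  have hp2 : p ≠ 2 := by omega
  obtain ⟨hcast, -⟩ := pStar_intCast p
  have hd0 : ((((-1 : ℤ) ^ (p / 2) * p : ℤ)) : ℚ) ≠ 0 := by
    push_cast
    exact mul_ne_zero (pow_ne_zero _ (by norm_num)) (by exact_mod_cast hp.ne_zero)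
  haveI : (W.quadraticTwist ((((-1 : ℤ) ^ (p / 2) * p : ℤ)) : ℚ)).IsElliptic := W.isElliptic_quadraticTwist hd0
  have hadd : Addv W p := not_good_and_not_mult_of_sq_dvd_conductorNorm W hpN
  have hj : 0 ≤ padicValRat p W.j := padicValRat_j_nonneg_of_addv_of_twist_pStar_not_semistable W p hp2 hadd htw
  -- `p² ∣ N(W ⊗ p*)` from the local hypothesis
  have hpT : p ^ 2 ∣ (W.quadraticTwist ((((-1 : ℤ) ^ (p / 2) * p : ℤ)) : ℚ)).conductorNorm ℤ := by
    set v : HeightOneSpectrum ℤ := (Rat.HeightOneSpectrum.primesEquiv (R := ℤ)).symm ⟨p, hp⟩ with hv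
    have hgen : natGenerator v = p :=
      congrArg Subtype.val ((Rat.HeightOneSpectrum.primesEquiv (R := ℤ)).apply_symm_apply ⟨p, hp⟩)
    rcases hasGoodReductionAt_or_hasMultiplicativeReductionAt_or_hasAdditiveReductionAt v
        (W.quadraticTwist ((((-1 : ℤ) ^ (p / 2) * p : ℤ)) : ℚ)) with hg | hm | ha
    · exact absurd (Or.inl hg) htw
    · exact absurd (Or.inr hm) htw
    · have h2 := (natGenerator_sq_dvd_conductorNorm_iff v
        (W.quadraticTwist ((((-1 : ℤ) ^ (p / 2) * p : ℤ)) : ℚ))).mpr ha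
      rwa [hgen] at h2
  -- the globally minimal model `C` of `W ⊗ p*`: additive at `p`, `0 ≤ ord_p j`, `ord_p Δ_min(C) = ord_p Δ_min(W) + 6 − 12 m`
  obtain ⟨u, hCmin⟩ := hasGlobalMinimalModel_rat_holds (W.quadraticTwist ((((-1 : ℤ) ^ (p / 2) * p : ℤ)) : ℚ))
  set C : WeierstrassCurve ℚ := u • W.quadraticTwist ((((-1 : ℤ) ^ (p / 2) * p : ℤ)) : ℚ) with hCdef
  haveI : C.IsGloballyMinimal := hCmin
  have hAddC : Addv C p := by
    refine not_good_and_not_mult_of_sq_dvd_conductorNorm C ?_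
    rw [hCdef, conductorNorm_smul_rat]
    exact hpT
  have hjC : 0 ≤ padicValRat p C.j := by
    have hjCW : C.j = W.j := j_eq_of_smul_quadraticTwist_eq hd0 u hCdef.symm
    rw [hjCW]; exact hj
  have hvC' : (padicValInt p C.minimalDiscriminantInt : ℤ) =
      padicValInt p W.minimalDiscriminantInt + 6 - 12 * padicValRat p (u.u : ℚ) :=
    padicValInt_minimalDiscriminantInt_twist_pStar_eq p W C u (by rw [← hcast])
  obtain ⟨m, hm⟩ : ∃ m : ℤ, padicValRat p (u.u : ℚ) = m := ⟨_, rfl⟩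
  rw [hm] at hvC'
  have hmemC := padicValInt_minimalDiscriminantInt_mem_of_addv_of_padicValRat_j_nonneg C p hp5 hAddC hjC
  intro h6
  rw [h6] at hvC'
  rcases hmemC with h' | h' | h' | h' | h' | h' | h' <;> rw [h'] at hvC' <;> omega

/-- **`OrdinaryCornerOffTable` (route `TwistFamilyManinDescent`, stmt-BirchSwinnertonDyer-27663) is a THEOREM** (signature VERBATIM):
the rows of `OrdinaryCornerManinResidual` (stmt-27552) outside the ordinary table `(5; 3, 9)`, `(7; 2, 4, 8, 10)` — after the Raynaud
rows `(5; 4, 8)`, `(7; 3, 9)` and the supersingular rows `(5; 2, 10)` are removed — are EMPTY: level = conductor (Carayol via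
modularity), `p² ∣ N` makes `W` additive at `p`, the twist hypothesis gives `0 ≤ ord_p j`, so `ord_p Δ_min ∈ {2,3,4,6,8,9,10}` and
only `6` would remain, excluded by `padicValInt_minimalDiscriminantInt_ne_six_of_twist_pStar_not_semistable`. No new mathematics;
closes stmt-27663 by name. [cite: SilvermanATAEC1994, IV Table 4.1 and IV.10.4] [cite: Carayol1986] -/
theorem ordinaryCornerOffTable_proof : OrdinaryCornerOffTable := by
  intro hM hAU hC hnf W _ _ N _ D p hp h57 hRay hSS hOrd hpN hred htw hopt
  haveI hpF : Fact p.Prime := ⟨hp⟩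
  obtain rfl : N = W.conductorNorm ℤ := IsNewformOf.level_eq_conductorNorm_of_exists_isNewformOf hnf D.isNewformOf
  have hp5 : 5 ≤ p := by rcases h57 with rfl | rfl <;> norm_num
  have hp2 : p ≠ 2 := by omega
  have hadd : Addv W p := not_good_and_not_mult_of_sq_dvd_conductorNorm W hpN
  have hj : 0 ≤ padicValRat p W.j := padicValRat_j_nonneg_of_addv_of_twist_pStar_not_semistable W p hp2 hadd htw
  have h6 := padicValInt_minimalDiscriminantInt_ne_six_of_twist_pStar_not_semistable hp5 W hpN htw
  have hmem := padicValInt_minimalDiscriminantInt_mem_of_addv_of_padicValRat_j_nonneg W p hp5 hadd hj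
  exfalso
  rcases h57 with rfl | rfl
  · rcases hmem with h | h | h | h | h | h | h
    · exact hSS ⟨rfl, by simp [h]⟩
    · exact hOrd (Or.inl ⟨rfl, by simp [h]⟩)
    · exact hRay (Or.inl ⟨rfl, by simp [h]⟩)
    · exact h6 h
    · exact hRay (Or.inl ⟨rfl, by simp [h]⟩)
    · exact hOrd (Or.inl ⟨rfl, by simp [h]⟩)
    · exact hSS ⟨rfl, by simp [h]⟩
  · rcases hmem with h | h | h | h | h | h | h
    · exact hOrd (Or.inr ⟨rfl, by simp [h]⟩)
    · exact hRay (Or.inr ⟨rfl, by simp [h]⟩)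
    · exact hOrd (Or.inr ⟨rfl, by simp [h]⟩)
    · exact h6 h
    · exact hOrd (Or.inr ⟨rfl, by simp [h]⟩)
    · exact hRay (Or.inr ⟨rfl, by simp [h]⟩)
    · exact hOrd (Or.inr ⟨rfl, by simp [h]⟩)

end Summit.BirchSwinnertonDyer.BirchSwinnertonDyer.Theorems

end
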